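import Mathlib
import Literature.NumberTheory.EllipticCurves.Smith2016.CongruentNumberGenusDeterminantRowThreeHolds
import Literature.NumberTheory.EllipticCurves.Smith2016.CongruentNumberSmithMatrixSelmer

/-!
# Smith 2016, Theorem 2.2 row 5a for every `k`: `ℒ_{5a}(n) = |M₁ bordered by y + z|`, and `Σ₁(n)` odd `⟹ #Sel₂(E⁽ⁿ⁾) = 8` (`n ≡ 5 (8)`)

A. Smith, *The congruent numbers have positive natural density*, arXiv:1603.08479 [Smith2016CongruentDensity],
Table 2 row 5(a) (source `cnc.tex` l. 70–126, transcribed in the cell's `lit/SMITH2016-VERBATIM-SHEET.md`):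
`ℒ_{5a}(n) = Σ_{d | n, d ≡ 5 (8)} g(d) ℒ(n/d)`, `M_{5a} = [[A + Aᵀ, Aᵀ, y + z],[A, D_z, 0],[(y + z)ᵀ, 0, 0]]`
(`(2r+1) × (2r+1)`); Thm. 2.2: `ℒ_{5a}(n) = det M_{5a}` for `n ≡ 5 (8)`; §2.2 (chunk p0008 L50–L55): "Taking
`u = y + z` … `d` must be `5` mod `8`, and we see that the first determinant is again `g(d)`."  For
`n ≡ 5 (8)` square-free, `ℒ_{5a}(n)` IS Tian–Yuan–Zhang's first genus sum
`Σ₁(n) = Σ_{n = d₀⋯d_ℓ, dᵢ ≡ 1 (8) (i > 0)} ∏ g(dᵢ)` (the factor `d₀ ≢ 1 (8)` is unique and `≡ 5 (8)`).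

What is proved (every number of prime factors; no named fact):
* `genusSum₁_eq_border_adjugate_five` — **row 5a**: for `n = p₁⋯p_k ≡ 5 (mod 8)`,
  `Σ₁(n) ≡ uᵀ adj(M₁) u (mod 2)` with `u = (y + z; 0)` and `M₁ = [[A + Aᵀ, Aᵀ],[A, D_z]]` (the bordered
  determinant `det [[M₁, u],[uᵀ, 0]] = uᵀ adj(M₁) u` over `𝔽₂`).  Proof: `adj(M₁)` transports to the adjugate of
  the doubled forest matrix `N = E M₁ Eᵀ` (`E = [[I,I],[0,I]]`, `adj E = E`), whose mark-copy principal
  cofactors are pointed forest sums (`BipartiteForestCofactor`); the pointed weight `(t_B + z_B) q_z(A^B)` is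
  `[d_B ≡ 5 (8)] g(d_B)` (Smith's Table 1 dictionary); the anchored regrouping of
  `CongruentNumberGenusDeterminantRowThreeHolds` identifies the result with `Σ₁(n)`.
* `card_selmerGroup_two_eq_eight_of_odd_genusSum₁_five` — **for `n = p₁⋯p_k ≡ 5 (mod 8)` with `Σ₁(n)` odd,
  `#Sel⁽²⁾(E⁽ⁿ⁾/ℚ) = 8`** (Smith's Prop. 3.2: `ℒ_{5a}(n) ≠ 0 ⟹ rk Sel⁽²⁾ = 3`; here: `adj(M₁) ≠ 0` forces
  `rank M₁ ≥ 2k − 1`, i.e. Monsky's `s(n) ≤ 1`, and `s(n)` is odd), and the enumeration-free form for every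
  square-free `N ≡ 5 (mod 8)`.  By Tian–Yuan–Zhang's Theorem 1.4 (not used here) the same hypothesis gives
  analytic rank one; this file is its `2`-Selmer shadow, with no `L`-function.
-/

namespace Literature.NumberTheory.EllipticCurves.Smith2016

open _root_.Matrix Finset Literature.LinearAlgebra.Matrix Literature.Combinatorics.Enumerative
open Literature.NumberTheory.EllipticCurves.HeathBrown1994
open Literature.NumberTheory.EllipticCurves.TianYuanZhang2017
open Literature.NumberTheory.EllipticCurves.HeathBrown1994.Families (legendreMatrix_apply_of_ne legendreMatrix_apply_self)
open Literature.NumberTheory.EllipticCurves.MonskySelmerParity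

section Transport

variable {V : Type*} [Fintype V] [DecidableEq V]

/-- The congruence matrix `E = [[I, I],[0, I]]` is an involution over `𝔽₂`. [cite: Smith2016CongruentDensity, §2 Thm. 2.2 row 1 (M₁ congruent to the doubled matrix)] -/
theorem fromBlocks_one_one_zero_one_mul_self :
    fromBlocks (1 : Matrix V V (ZMod 2)) (1 : Matrix V V (ZMod 2)) (0 : Matrix V V (ZMod 2)) (1 : Matrix V V (ZMod 2)) *
      fromBlocks (1 : Matrix V V (ZMod 2)) (1 : Matrix V V (ZMod 2)) (0 : Matrix V V (ZMod 2)) (1 : Matrix V V (ZMod 2)) = 1 := by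
  rw [fromBlocks_multiply]
  simp only [Matrix.mul_one, Matrix.mul_zero, add_zero, zero_add, matrix_add_self]
  exact fromBlocks_one

/-- `adj(E) = E` for `E = [[I, I],[0, I]]` over `𝔽₂` (`E² = I`, `det E = 1`).
[cite: HornJohnson2013, §0.8.2 (A adj(A) = det(A) I)] -/
theorem adjugate_fromBlocks_one_one_zero_one :
    (fromBlocks (1 : Matrix V V (ZMod 2)) (1 : Matrix V V (ZMod 2)) (0 : Matrix V V (ZMod 2)) (1 : Matrix V V (ZMod 2))).adjugate =
      fromBlocks (1 : Matrix V V (ZMod 2)) (1 : Matrix V V (ZMod 2)) (0 : Matrix V V (ZMod 2)) (1 : Matrix V V (ZMod 2)) := by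
  have hdet : (fromBlocks (1 : Matrix V V (ZMod 2)) (1 : Matrix V V (ZMod 2)) (0 : Matrix V V (ZMod 2)) (1 : Matrix V V (ZMod 2))).det = 1 := by
    rw [det_fromBlocks_zero₂₁, det_one, mul_one]
  have h := mul_adjugate (fromBlocks (1 : Matrix V V (ZMod 2)) (1 : Matrix V V (ZMod 2)) (0 : Matrix V V (ZMod 2)) (1 : Matrix V V (ZMod 2)))
  rw [hdet, one_smul] at h
  have h2 := congrArg (fun X => fromBlocks (1 : Matrix V V (ZMod 2)) (1 : Matrix V V (ZMod 2)) (0 : Matrix V V (ZMod 2)) (1 : Matrix V V (ZMod 2)) * X) h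
  rw [← Matrix.mul_assoc, fromBlocks_one_one_zero_one_mul_self, Matrix.one_mul, Matrix.mul_one] at h2
  exact h2

/-- **Transport of the bordered form along the congruence**: for `u = (x; 0)` (supported on the first block,
fixed by `E`), `uᵀ adj(M₁) u = uᵀ adj(E M₁ Eᵀ) u`, where `M₁ = [[A + Aᵀ, Aᵀ],[A, D]]` and
`E M₁ Eᵀ = [[D, Aᵀ + D],[A + D, D]]`. [cite: Smith2016CongruentDensity, §2.2 (the bordered determinants of rows 3, 5a)] [cite: HornJohnson2013, §0.8.2 (adj(AB) = adj(B) adj(A))] -/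
theorem border_adjugate_transport (A D : Matrix V V (ZMod 2)) (x : V → ZMod 2) :
    Sum.elim x (0 : V → ZMod 2) ⬝ᵥ ((fromBlocks (A + Aᵀ) Aᵀ A D).adjugate *ᵥ Sum.elim x (0 : V → ZMod 2)) =
      Sum.elim x (0 : V → ZMod 2) ⬝ᵥ
        ((fromBlocks D (Aᵀ + D) (A + D) D).adjugate *ᵥ Sum.elim x (0 : V → ZMod 2)) := by
  have hEt : (fromBlocks (1 : Matrix V V (ZMod 2)) (1 : Matrix V V (ZMod 2)) (0 : Matrix V V (ZMod 2)) (1 : Matrix V V (ZMod 2)))ᵀ =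
      fromBlocks (1 : Matrix V V (ZMod 2)) (0 : Matrix V V (ZMod 2)) (1 : Matrix V V (ZMod 2)) (1 : Matrix V V (ZMod 2)) := by
    rw [fromBlocks_transpose, transpose_one, transpose_zero]
  have hconj := conj_fromBlocks_add_transpose A D
  rw [← hEt] at hconj
  have hEu : fromBlocks (1 : Matrix V V (ZMod 2)) (1 : Matrix V V (ZMod 2)) (0 : Matrix V V (ZMod 2)) (1 : Matrix V V (ZMod 2)) *ᵥ Sum.elim x (0 : V → ZMod 2) = Sum.elim x 0 := by
    rw [fromBlocks_mulVec]
    ext (i | i) <;> simp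
  rw [← hconj, adjugate_mul_distrib, adjugate_mul_distrib, ← adjugate_transpose,
    adjugate_fromBlocks_one_one_zero_one, ← mulVec_mulVec, ← mulVec_mulVec, hEu]
  conv_rhs => rw [dotProduct_mulVec, vecMul_transpose, hEu]

/-- The bordered form of a symmetric matrix over `𝔽₂` only sees the diagonal cofactors of the first block:
`(x; 0)ᵀ adj(N) (x; 0) = Σ_j x_j adj(N)_{(inl j),(inl j)}`. [cite: HornJohnson2013, §4.1 (quadratic form of a symmetric matrix), characteristic 2] -/
theorem border_adjugate_eq_sum {N : Matrix (V ⊕ V) (V ⊕ V) (ZMod 2)} (hN : Nᵀ = N) (x : V → ZMod 2) :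
    Sum.elim x (0 : V → ZMod 2) ⬝ᵥ (N.adjugate *ᵥ Sum.elim x (0 : V → ZMod 2)) =
      ∑ j, x j * N.adjugate (Sum.inl j) (Sum.inl j) := by
  have hadj : (N.adjugate)ᵀ = N.adjugate := by rw [adjugate_transpose, hN]
  rw [dotProduct_mulVec_eq_sum_diag hadj, Fintype.sum_sum_type]
  simp only [Sum.elim_inl, Sum.elim_inr, Pi.zero_apply, mul_zero, sum_const_zero, add_zero]
  exact sum_congr rfl fun j _ => mul_comm _ _

end Transport

variable {k : ℕ} (p : Fin k → ℕ)

section RowFiveA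

/-- **The pointed weight of row 5a**: `(Σ_{j : p_j ∣ d} (t_j + z_j)) · ν(d) = [d ≡ 5 (8)] · g(d)` for every
divisor `d > 1` of `∏ pᵢ` (`Σ_B (t + z) = [d ≡ 5, 7 (8)]`, and `ν(d) = [d ≡ 1 (4) ∨ d ≡ 3 (8)] g(d)`).
[cite: Smith2016CongruentDensity, §2.2 (chunk p0008 L50–L55: "Taking u = y + z … d must be 5 mod 8")] -/
theorem anchoredWeight_eq_genusWeight_five (hp : ∀ i, (p i).Prime) (hodd : ∀ i, Odd (p i))
    (hinj : Function.Injective p) {d : ℕ} (hd : d ∣ ∏ i, p i) (hd1 : 1 < d) :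
    (∑ j ∈ univ.filter (fun j => p j ∣ d), (addLegendreSym (-1) (p j) + addLegendreSym 2 (p j))) *
        (if d % 4 = 1 then ((genusClassNumber (GenusField d) : ℕ) : ZMod 2)
          else if d % 8 = 3 then ((genusClassNumber (GenusField d) : ℕ) : ZMod 2) else 0) =
      if d % 8 = 5 then ((genusClassNumber (GenusField d) : ℕ) : ZMod 2) else 0 := by
  set B : Finset (Fin k) := univ.filter (fun j => p j ∣ d) with hB
  have hdB : d = ∏ i ∈ B, p i := eq_blockProd_filter_of_dvd p hp hinj univ hd
  have hBne : B.Nonempty := by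
    by_contra h
    rw [not_nonempty_iff_eq_empty] at h
    rw [h, prod_empty] at hdB
    omega
  set q : Fin B.card → ℕ := fun x => p ((B.equivFin.symm x : {i // i ∈ B}) : Fin k) with hq
  have hqp : ∀ x, (q x).Prime := fun x => hp _
  have hqo : ∀ x, Odd (q x) := fun x => hodd _
  have hq2 : ∀ x, q x ≠ 2 := ne_two_of_odd q hqo
  have hprod : ∏ x, q x = ∏ i ∈ B, p i := prod_subtuple p B
  have hdodd : (∏ i ∈ B, p i) % 2 = 1 := Nat.odd_iff.mp (hprod ▸ MonskySelmerParity.odd_prod q hqp hq2)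
  have ht : ∑ i ∈ B, addLegendreSym (-1) (p i) = if (∏ i ∈ B, p i) % 4 = 1 then 0 else 1 := by
    rw [← sum_subtuple p B (fun n => addLegendreSym (-1) n), sum_addLegendreSym_neg_one_eq q hqp hq2, hprod]
  have hz : ∑ i ∈ B, addLegendreSym 2 (p i) =
      if (∏ i ∈ B, p i) % 8 = 3 ∨ (∏ i ∈ B, p i) % 8 = 5 then (1 : ZMod 2) else 0 :=
    HeathBrown1994.Families.sum_addLegendreSym_two_eq B p fun i _ => Nat.odd_iff.mp (hodd i)
  rw [hdB, sum_add_distrib, ht, hz]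
  have h11 : (1 : ZMod 2) + 1 = 0 := by decide
  by_cases h1 : (∏ i ∈ B, p i) % 8 = 1
  · rw [if_pos (by omega), if_neg (by omega), if_pos (by omega), if_neg (by omega), zero_add, zero_mul]
  · by_cases h3 : (∏ i ∈ B, p i) % 8 = 3
    · rw [if_neg (by omega), if_pos (Or.inl h3), if_neg (by omega), if_pos h3, if_neg (by omega), h11,
        zero_mul]
    · by_cases h5 : (∏ i ∈ B, p i) % 8 = 5
      · rw [if_pos (by omega), if_pos (Or.inr h5), if_pos (by omega), if_pos h5, zero_add, one_mul]
      · have h7 : (∏ i ∈ B, p i) % 8 = 7 := by omega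
        rw [if_neg (by omega), if_neg (by omega), if_neg (by omega), if_neg (by omega), if_neg (by omega),
          mul_zero]

/-- For `n ≡ 5 (mod 8)` and a decomposition `D` of `n`: the pointed product
`Σ_{d₀ ∈ D} [d₀ ≡ 5 (8)] g(d₀) · ∏_{d ≠ d₀} [d ≡ 1 (8)] g(d)` is `∏_D g(d)` if `D` has at most one factor
`≢ 1 (mod 8)` (then exactly one, `≡ 5 (8)`), and `0` otherwise.
[cite: Smith2016CongruentDensity, §2 Table 2 row 5(a) (ℒ_{5a}(n) = Σ_{d | n, d ≡ 5 (8)} g(d) ℒ(n/d))] [cite: TianYuanZhang2017, Thm. 1.2/1.4 (the sum Σ₁ for n ≡ 5 (8))] -/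
theorem sum_pointed_prod_eq_ite_five {n : ℕ} (hn : n % 8 = 5) {D : Finset ℕ} (hD : D ∈ decompositions n)
    (g : ℕ → ℕ) :
    ∑ d₀ ∈ D, (if d₀ % 8 = 5 then ((g d₀ : ℕ) : ZMod 2) else 0) *
        ∏ d ∈ D.erase d₀, (if d % 8 = 1 then ((g d : ℕ) : ZMod 2) else 0) =
      if (D.filter fun d => d % 8 ≠ 1).card ≤ 1 then ((∏ d ∈ D, g d : ℕ) : ZMod 2) else 0 := by
  obtain ⟨-, -, -, hprod⟩ := mem_decompositions_iff.mp hD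
  by_cases hc : (D.filter fun d => d % 8 ≠ 1).card ≤ 1
  · rw [if_pos hc]
    have hex : ∃ d ∈ D, d % 8 ≠ 1 := by
      by_contra h
      push Not at h
      have : n % 8 = 1 := by
        rw [← hprod, Finset.prod_nat_mod, prod_congr rfl fun d hd => h d hd, prod_const_one]
        rfl
      omega
    obtain ⟨dstar, hds, hds8⟩ := hex
    have hF : {dstar} = D.filter (fun d => d % 8 ≠ 1) :=
      eq_of_subset_of_card_le (singleton_subset_iff.mpr (mem_filter.mpr ⟨hds, hds8⟩))
        (by rw [card_singleton]; exact hc)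
    have hothers : ∀ d ∈ D.erase dstar, d % 8 = 1 := by
      intro d hd
      by_contra h8
      have : d ∈ D.filter (fun d => d % 8 ≠ 1) := mem_filter.mpr ⟨mem_of_mem_erase hd, h8⟩
      rw [← hF, mem_singleton] at this
      exact ne_of_mem_erase hd this
    have hrest : (∏ d ∈ D.erase dstar, d) % 8 = 1 := by
      rw [Finset.prod_nat_mod, prod_congr rfl fun d hd => hothers d hd, prod_const_one]
      rfl
    have hds5 : dstar % 8 = 5 := by
      have h := mul_prod_erase D (fun d => d) hds
      rw [hprod] at h
      have : n % 8 = dstar % 8 := by rw [← h, Nat.mul_mod, hrest, mul_one, Nat.mod_mod]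
      omega
    rw [sum_eq_single_of_mem dstar hds (fun d hd hne => by
      rw [if_neg (by have := hothers d (mem_erase.mpr ⟨hne, hd⟩); omega), zero_mul]),
      if_pos hds5, prod_congr rfl fun d hd => if_pos (hothers d hd), ← Nat.cast_prod, ← Nat.cast_mul,
      mul_prod_erase D g hds]
  · rw [if_neg hc]
    refine sum_eq_zero fun d₀ hd₀ => ?_
    by_cases h5 : d₀ % 8 = 5
    · rw [if_pos h5]
      have hlt : 1 < (D.filter fun d => d % 8 ≠ 1).card := by omega
      obtain ⟨d', hd', hne⟩ := exists_mem_ne hlt d₀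
      rw [mem_filter] at hd'
      rw [prod_eq_zero (mem_erase.mpr ⟨hne, hd'.1⟩) (if_neg hd'.2), mul_zero]
    · rw [if_neg h5, zero_mul]

/-- For `n ≡ 5 (mod 8)`, `Σ₁(n) = genusSum₁ n g` in `𝔽₂` is the pointed decomposition sum
`Σ_D Σ_{d₀ ∈ D} [d₀ ≡ 5 (8)] g(d₀) ∏_{d ≠ d₀} [d ≡ 1 (8)] g(d)` (Smith's `ℒ_{5a}(n)` unrolled).
[cite: Smith2016CongruentDensity, §2 Table 2 row 5(a) with Thm. 2.1] [cite: TianYuanZhang2017, Thm. 1.2 (journal numbering), the sum Σ₁] -/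
theorem natCast_genusSum₁_eq_sum_pointed_five {n : ℕ} (hn : n % 8 = 5) (g : ℕ → ℕ) :
    ((genusSum₁ n g : ℕ) : ZMod 2) =
      ∑ D ∈ decompositions n, ∑ d₀ ∈ D, (if d₀ % 8 = 5 then ((g d₀ : ℕ) : ZMod 2) else 0) *
        ∏ d ∈ D.erase d₀, (if d % 8 = 1 then ((g d : ℕ) : ZMod 2) else 0) := by
  unfold genusSum₁
  rw [Nat.cast_sum, sum_filter]
  refine sum_congr rfl fun D hD => ?_
  rw [sum_pointed_prod_eq_ite_five hn hD g]

/-- **Smith 2016, Theorem 2.2 row 5a — for every `k`**: for `n = p₁⋯p_k ≡ 5 (mod 8)` a product of distinct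
odd primes, `Σ₁(n) = ℒ_{5a}(n) ≡ uᵀ adj(M₁) u (mod 2)` with `u = ((−1/pᵢ)₊ + (2/pᵢ)₊; 0)` and
`M₁ = [[A + Aᵀ, Aᵀ],[A, D_z]]` — the determinant of Smith's bordered matrix `M_{5a} = [[M₁, u],[uᵀ, 0]]`.
[cite: Smith2016CongruentDensity, Thm. 2.2 row 5(a) (Table 2, source cnc.tex l. 70–126) and §2.2 (chunk p0008 L30–L55)] -/
theorem genusSum₁_eq_border_adjugate_five (hp : ∀ i, (p i).Prime) (hodd : ∀ i, Odd (p i))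
    (hinj : Function.Injective p) (h8 : (∏ i, p i) % 8 = 5) :
    ((genusSum₁ (∏ i, p i) (fun d => genusClassNumber (GenusField d)) : ℕ) : ZMod 2) =
      Sum.elim (fun i => addLegendreSym (-1) (p i) + addLegendreSym 2 (p i)) (0 : Fin k → ZMod 2) ⬝ᵥ
        ((fromBlocks (legendreMatrix p + (legendreMatrix p)ᵀ) (legendreMatrix p)ᵀ (legendreMatrix p)
            (legendreDiagonal p 2)).adjugate *ᵥ
          Sum.elim (fun i => addLegendreSym (-1) (p i) + addLegendreSym 2 (p i)) (0 : Fin k → ZMod 2)) := by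
  set N := bigN (fun i j => legendreMatrix p i j) univ (fun i => addLegendreSym 2 (p i))
    (fun i => addLegendreSym 2 (p i)) (fun i => addLegendreSym 2 (p i)) with hN
  -- transport to the doubled forest matrix
  have hD2 : legendreDiagonal p 2 = diagonal fun i => addLegendreSym 2 (p i) := rfl
  have hNeq : fromBlocks (legendreDiagonal p 2) ((legendreMatrix p)ᵀ + legendreDiagonal p 2)
      (legendreMatrix p + legendreDiagonal p 2) (legendreDiagonal p 2) = N := by
    rw [hN, bigN_univ_eq_fromBlocks _ (legendreMatrix_apply_self p), hD2, transpose_add, diagonal_transpose]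
  rw [border_adjugate_transport, hNeq, border_adjugate_eq_sum (bigN_transpose _ _ _ _ _),
    natCast_genusSum₁_eq_sum_pointed_five h8]
  -- each cofactor is an anchored decomposition sum; regroup the anchors
  have hj : ∀ j, (addLegendreSym (-1) (p j) + addLegendreSym 2 (p j)) * N.adjugate (Sum.inl j) (Sum.inl j) =
      ∑ D ∈ decompositions (∏ i, p i), (addLegendreSym (-1) (p j) + addLegendreSym 2 (p j)) * ∏ d ∈ D,
        (if p j ∣ d then
          (if d % 4 = 1 then ((genusClassNumber (GenusField d) : ℕ) : ZMod 2)
            else if d % 8 = 3 then ((genusClassNumber (GenusField d) : ℕ) : ZMod 2) else 0)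
        else (if d % 8 = 1 then ((genusClassNumber (GenusField d) : ℕ) : ZMod 2) else 0)) := by
    intro j
    rw [hN, adjugate_bigN_legendre_inl_eq_sum_decompositions p hp hodd hinj j, mul_sum]
  rw [Fintype.sum_congr _ _ hj, sum_comm]
  refine sum_congr rfl fun D hD => ?_
  rw [sum_mul_prod_anchored p hp hinj _ _ _ hD]
  refine sum_congr rfl fun d₀ hd₀ => ?_
  obtain ⟨hsub, hgt, -, -⟩ := mem_decompositions_iff.mp hD
  have hdvd : d₀ ∣ ∏ i, p i := (Nat.mem_divisors.mp (hsub hd₀)).1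
  rw [← mul_assoc, anchoredWeight_eq_genusWeight_five p hp hodd hinj hdvd (hgt d₀ hd₀)]

end RowFiveA

end Literature.NumberTheory.EllipticCurves.Smith2016
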